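import Mathlib
import Literature.Geometry.Lorentzian.KerrConvergence
import Literature.Geometry.Lorentzian.TameChartCompactness
import Literature.Geometry.Lorentzian.CurvatureNaturality
import Literature.Geometry.Lorentzian.ImmersionChartMetric
import Literature.Geometry.Lorentzian.BoundedGeometry
import Literature.Geometry.Lorentzian.LeviCivitaProofs
import Summits.FinalStateConjecture.FinalStateConjecture.Theorems.PhotonSphereChannelsTameCensorshipNullLegLowerBound
import Summits.FinalStateConjecture.FinalStateConjecture.Theorems.PhotonSphereChannelsTameCensorshipScreenFrame

/-!
# Route PhotonSphereChannels · crux `TameCensorship` (stmt-FinalStateConjecture-17431) · line `Sketch`, skeleton v6 ·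
# the adapted null frame of a tame chart and the weight table (glue for the pancake law)

Helper file (`--supports stmt-FinalStateConjecture-17431`) of line `Sketch` (lead c2, 2026-08-17). Three pieces of glue of
the PANCAKE LAW (tail form), between the landed bricks and the assembly:

* `adaptedNullFrame_of_pin` — under the pin `‖G − η‖ ≤ ½` every non-zero `G`-null `ℓ` completes to an adapted null
  frame `(ℓ, n, e₂, e₃)` with the CHART-NORM BOUNDS `‖n‖ ‖ℓ‖ ≤ 24`, `‖e_A‖ ≤ 74` (over the landed
  `stub_nullLegLowerBound`, `stub_screenFrame`);
* `val_riemann_immersionChart` — the curvature of the development read through a chart `Ψ` is the curvature of the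
  transported metric `Ψ^* g` on the chart domain (naturality of the Riemann tensor, `riemann_comap_apply`);
* `slot_norm_le_mul_zpow`, `table_bound` — the weight-table algebra: chart norms `u`, `≤ 24/u`, `≤ 74`, `≤ 74` on the slots
  `ℓ, n, e₂, e₃` bound a quadrilinear quantity by `74⁴ · u ^ (#ℓ − #n)`;
* `exists_first_exit` — the first exit time of a continuous curve from an open set it must leave (order topology of `ℝ`).

References: B. O'Neill, *Semi-Riemannian Geometry* (1983), Ch. 3, Prop. 3.59 (naturality of curvature); Ch. 5,
Lemma 26 ff. (null frames).
-/

set_option linter.dupNamespace false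
-- instance search through the nested operator type `E4 →L[ℝ] E4 →L[ℝ] ℝ` of metric components
set_option maxSynthPendingDepth 3

open Literature.Geometry.Lorentzian
open scoped Manifold ContDiff Topology
open Set Filter TopologicalSpace

noncomputable section

namespace Summit.FinalStateConjecture.FinalStateConjecture.Theorems.PhotonSphereChannels.TameCensorshipUnwind

/-! ### The adapted null frame under the pin -/

/-- Scalar core of `adaptedNullFrame_of_pin`: with `L ≤ 5|s|`, `s ≠ 0`, `|c| ≤ ¾ |s|⁻²` one has
`(|s|⁻¹ + |c| L) L ≤ 24`. [folklore] -/
theorem frame_scalar_le {L s c : ℝ} (hL0 : 0 ≤ L) (hL : L ≤ 5 * |s|) (hs : s ≠ 0)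
    (hc : |c| ≤ 3 / 4 * (|s|⁻¹) ^ 2) : (|s|⁻¹ + |c| * L) * L ≤ 24 := by
  have hs' : 0 < |s| := abs_pos.2 hs
  have h1 : |s|⁻¹ * L ≤ 5 := by
    rw [inv_mul_le_iff₀ hs']; linarith
  have h2 : |c| * L * L ≤ 75 / 4 := by
    have : |c| * L * L ≤ 3 / 4 * (|s|⁻¹) ^ 2 * (5 * |s|) * (5 * |s|) := by
      gcongr
    refine this.trans (le_of_eq ?_)
    field_simp
    norm_num
  nlinarith [h1, h2]

/-- **The adapted null frame under the pin.** For a symmetric bilinear form `G` on `E4` with `‖G − η‖ ≤ ½` and a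
non-zero `G`-null `ℓ`, there are a conjugate null leg `n` (`G(n,n) = 0`, `G(ℓ,n) = −1`) and a `G`-orthonormal
screen `e₂, e₃` orthogonal to both legs, with the CHART-NORM BOUNDS `‖n‖ ‖ℓ‖ ≤ 24`, `‖e_A‖ ≤ 74`. Construction:
`s := G(ℓ, ∂₀) ≠ 0` by `stub_nullLegLowerBound`, `n̂ := −s⁻¹ ∂₀`, `n := n̂ + ½ G(n̂,n̂) ℓ`; the screen is
`stub_screenFrame`. O'Neill 1983, Ch. 5, Lemma 26 (a null and a timelike vector are never orthogonal).
[cite: ONeillSemiRiemannian1983, Ch. 5, Lemma 26] -/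
theorem adaptedNullFrame_of_pin (G : E4 →L[ℝ] E4 →L[ℝ] ℝ) (hG : ∀ v w : E4, G v w = G w v)
    (hpin : ‖G - Minkowski.bilin‖ ≤ 1 / 2) {ℓ : E4} (hℓ : G ℓ ℓ = 0) (hℓ0 : ℓ ≠ 0) :
    ∃ n e₂ e₃ : E4, G n n = 0 ∧ G ℓ n = -1 ∧ G e₂ e₂ = 1 ∧ G e₃ e₃ = 1 ∧ G e₂ e₃ = 0 ∧
      G ℓ e₂ = 0 ∧ G ℓ e₃ = 0 ∧ G n e₂ = 0 ∧ G n e₃ = 0 ∧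
      ‖n‖ * ‖ℓ‖ ≤ 24 ∧ ‖e₂‖ ≤ 74 ∧ ‖e₃‖ ≤ 74 := by
  set V : E4 := E4.basisVector 0 with hV
  set s : ℝ := G ℓ V with hs
  have hℓs : ‖ℓ‖ ≤ 5 * |s| := stub_nullLegLowerBound G hG hpin ℓ hℓ
  have hℓpos : 0 < ‖ℓ‖ := norm_pos_iff.2 hℓ0
  have hs0 : s ≠ 0 := by
    intro h
    rw [h, abs_zero, mul_zero] at hℓs
    exact absurd hℓs (not_le.mpr hℓpos)
  have hVn : ‖V‖ = 1 := by simp [hV, E4.basisVector]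
  set nh : E4 := (-s⁻¹) • V with hnh
  have hℓnh : G ℓ nh = -1 := by
    simp only [hnh, map_smul, smul_eq_mul]
    rw [← hs]; field_simp
  have hnhℓ : G nh ℓ = -1 := (hG nh ℓ).trans hℓnh
  have hnhn : ‖nh‖ = |s|⁻¹ := by
    rw [hnh, norm_smul, hVn, mul_one, norm_neg, norm_inv, Real.norm_eq_abs]
  set c : ℝ := G nh nh / 2 with hc
  set n : E4 := nh + c • ℓ with hn
  have hℓn : G ℓ n = -1 := by
    simp only [hn, map_add, map_smul, smul_eq_mul, hℓnh, hℓ]; ring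
  have hnn : G n n = 0 := by
    simp only [hn, map_add, map_smul, add_apply, smul_apply, smul_eq_mul, hℓnh, hnhℓ, hℓ, hc]; ring
  have hGn : ‖G‖ ≤ 3 / 2 := by
    have h1 := norm_sub_norm_le G Minkowski.bilin
    linarith [Minkowski.norm_bilin_le_one]
  have hcb : |c| ≤ 3 / 4 * (|s|⁻¹) ^ 2 := by
    have h2 : ‖G nh nh‖ ≤ ‖G‖ * ‖nh‖ * ‖nh‖ := G.le_opNorm₂ nh nh
    rw [Real.norm_eq_abs, hnhn] at h2
    rw [hc, abs_div, abs_two]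
    have : ‖G‖ * |s|⁻¹ * |s|⁻¹ ≤ 3 / 2 * |s|⁻¹ * |s|⁻¹ := by gcongr
    nlinarith [h2, this]
  have hnorm : ‖n‖ * ‖ℓ‖ ≤ 24 := by
    have h3 : ‖n‖ ≤ |s|⁻¹ + |c| * ‖ℓ‖ := by
      calc ‖n‖ ≤ ‖nh‖ + ‖c • ℓ‖ := norm_add_le _ _
        _ = |s|⁻¹ + |c| * ‖ℓ‖ := by rw [hnhn, norm_smul, Real.norm_eq_abs]
    calc ‖n‖ * ‖ℓ‖ ≤ (|s|⁻¹ + |c| * ‖ℓ‖) * ‖ℓ‖ := by gcongr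
      _ ≤ 24 := frame_scalar_le hℓpos.le hℓs hs0 hcb
  obtain ⟨e₂, e₃, h22, h33, h23, hℓ2, hℓ3, hn2, hn3, he2, he3⟩ :=
    stub_screenFrame G hG hpin ℓ n hℓ hℓn
  have hprod : 2 + 3 * ‖ℓ‖ * ‖n‖ ≤ 74 := by nlinarith [hnorm]
  exact ⟨n, e₂, e₃, hnn, hℓn, h22, h33, h23, hℓ2, hℓ3, hn2, hn3, hnorm, he2.trans hprod, he3.trans hprod⟩

/-! ### The curvature of the development read through a chart -/

section Naturality

variable (𝓢 : Spacetime.{0} 4) (U : Opens E4) (Ψ : U → 𝓢.carrier)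
  (hΨ : ContMDiff 𝓘(ℝ, E4) (𝓡 4) (∞ + 1) Ψ)
  (hΨ' : ∀ u, Function.Injective (mfderiv 𝓘(ℝ, E4) (𝓡 4) Ψ u))
  (hdim : Module.finrank ℝ E4 = Module.finrank ℝ (EuclideanSpace ℝ (Fin 4)))

/-- **The curvature of `g` on pushed-forward vectors is the curvature of `Ψ^* g`** (naturality of the Riemann tensor
under the equidimensional immersion `Ψ`, O'Neill 1983, Ch. 3, Prop. 3.59, in the tree as `riemann_comap_apply`), paired
with the metric: `g(R^g(dΨ a, dΨ b) dΨ c, dΨ d) = (Ψ^*g)(R^{Ψ^*g}(a, b) c, d)`.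
[cite: ONeillSemiRiemannian1983, Ch. 3, Prop. 3.59] -/
theorem val_riemann_immersionChart [𝓢.metric.HasLeviCivita]
    [(ImmersionChart.metric 𝓢.metric.toPseudoRiemannianMetric hΨ hΨ' hdim).HasLeviCivita]
    (u : U) (a b c d : E4) :
    𝓢.metric.val (Ψ u)
        (𝓢.metric.toPseudoRiemannianMetric.riemann (Ψ u) (mfderiv 𝓘(ℝ, E4) (𝓡 4) Ψ u a)
          (mfderiv 𝓘(ℝ, E4) (𝓡 4) Ψ u b) (mfderiv 𝓘(ℝ, E4) (𝓡 4) Ψ u c))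
        (mfderiv 𝓘(ℝ, E4) (𝓡 4) Ψ u d) =
      (ImmersionChart.metric 𝓢.metric.toPseudoRiemannianMetric hΨ hΨ' hdim).val u
        ((ImmersionChart.metric 𝓢.metric.toPseudoRiemannianMetric hΨ hΨ' hdim).riemann u a b c) d := by
  haveI : (𝓢.metric.toPseudoRiemannianMetric.comap PseudoRiemannianMetric.contMDiff_pullbackBilin_holds Ψ hΨ hΨ'
      hdim).HasLeviCivita := ‹(ImmersionChart.metric 𝓢.metric.toPseudoRiemannianMetric hΨ hΨ' hdim).HasLeviCivita›
  have hnat := PseudoRiemannianMetric.riemann_comap_apply 𝓢.metric.toPseudoRiemannianMetric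
    PseudoRiemannianMetric.contMDiff_pullbackBilin_holds hΨ hΨ' hdim u a b c
  have hinv := PseudoRiemannianMetric.isInvertible_mfderiv_of_injective (I := 𝓡 4) (I' := 𝓘(ℝ, E4)) (Φ := Ψ)
    hdim (hΨ' u)
  rw [ImmersionChart.metric_val]
  change _ = 𝓢.metric.val (Ψ u) (mfderiv 𝓘(ℝ, E4) (𝓡 4) Ψ u
    ((𝓢.metric.toPseudoRiemannianMetric.comap PseudoRiemannianMetric.contMDiff_pullbackBilin_holds Ψ hΨ hΨ'
      hdim).riemann u a b c)) (mfderiv 𝓘(ℝ, E4) (𝓡 4) Ψ u d)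
  rw [hnat, ContinuousLinearMap.IsInvertible.self_apply_inverse hinv]

end Naturality

/-! ### The weight-table algebra -/

/-- One slot of the weight table: a chart norm `x` with `x = u` on slot `0`, `x ≤ 24/u` on slot `1`, `x ≤ 74` on the
screen slots is at most `74 · u ^ (slot weight)` for `0 < u`. [folklore] -/
theorem slot_norm_le_mul_zpow {u x : ℝ} (hu : 0 < u) (a : Fin 4)
    (h0 : a = 0 → x ≤ u) (h1 : a = 1 → x ≤ 24 / u) (h2 : a ≠ 0 → a ≠ 1 → x ≤ 74) :
    x ≤ 74 * u ^ ((if a = 0 then 1 else if a = 1 then -1 else 0 : ℤ)) := by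
  by_cases ha0 : a = 0
  · simp only [ha0, ↓reduceIte, zpow_one]
    have := h0 ha0
    nlinarith
  · by_cases ha1 : a = 1
    · subst ha1
      simp only [Fin.one_eq_zero_iff, OfNat.ofNat_ne_one, ↓reduceIte, zpow_neg, zpow_one]
      have := h1 rfl
      rw [div_eq_mul_inv] at this
      have hu' : 0 < u⁻¹ := inv_pos.2 hu
      nlinarith
    · simp only [ha0, ha1, ↓reduceIte, zpow_zero, mul_one]
      exact h2 ha0 ha1

/-- **The weight table.** If a quantity `Q` is bounded by `C₀ · ∏ᵢ xᵢ` over four slots whose chart norms satisfy the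
slot bounds of `slot_norm_le_mul_zpow` (`u` on `ℓ`, `24/u` on `n`, `74` on the screen), then
`Q ≤ C₀ · 74⁴ · u ^ (Σ slot weights)`. [folklore] -/
theorem table_bound {u C₀ Q : ℝ} (hu : 0 < u) (hC₀ : 0 ≤ C₀) (x : Fin 4 → ℝ) (hx : ∀ a, 0 ≤ x a)
    (h0 : ∀ a, a = 0 → x a ≤ u) (h1 : ∀ a, a = 1 → x a ≤ 24 / u) (h2 : ∀ a, a ≠ 0 → a ≠ 1 → x a ≤ 74)
    (a b c d : Fin 4) (hQ : Q ≤ C₀ * x a * x b * x c * x d) :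
    Q ≤ C₀ * 74 ^ 4 * u ^ ((if a = 0 then 1 else if a = 1 then -1 else 0 : ℤ) +
      (if b = 0 then 1 else if b = 1 then -1 else 0 : ℤ) + (if c = 0 then 1 else if c = 1 then -1 else 0 : ℤ) +
      (if d = 0 then 1 else if d = 1 then -1 else 0 : ℤ)) := by
  set w : Fin 4 → ℤ := fun a ↦ if a = 0 then 1 else if a = 1 then -1 else 0 with hw
  have hs : ∀ e : Fin 4, x e ≤ 74 * u ^ w e := fun e ↦ slot_norm_le_mul_zpow hu e (h0 e) (h1 e) (h2 e)
  have hune : u ≠ 0 := hu.ne'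
  have hpow : ∀ e : Fin 4, 0 < u ^ w e := fun e ↦ zpow_pos hu _
  calc Q ≤ C₀ * x a * x b * x c * x d := hQ
    _ ≤ C₀ * (74 * u ^ w a) * (74 * u ^ w b) * (74 * u ^ w c) * (74 * u ^ w d) := by
        have ha := hs a; have hb := hs b; have hc := hs c; have hd := hs d
        have := hx a; have := hx b; have := hx c; have := hx d
        gcongr
    _ = C₀ * 74 ^ 4 * u ^ (w a + w b + w c + w d) := by
        rw [zpow_add₀ hune, zpow_add₀ hune, zpow_add₀ hune]; ring

/-! ### First exit of a continuous curve from an open set -/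

/-- **First exit time.** Let `γ` be continuous at every point of an order-connected `dom ⊆ ℝ`, `O` an open set
containing `γ t`, `t ∈ dom`, and suppose `γ s₁ ∉ O` for some `s₁ ∈ dom`, `t ≤ s₁`. Then there is a first exit time
`T ∈ dom`, `t < T ≤ s₁`: `γ s ∈ O` for `s ∈ [t, T)`, `γ T ∉ O`, and `γ T ∈ closure O`. [folklore] -/
theorem exists_first_exit {X : Type*} [TopologicalSpace X] {γ : ℝ → X} {dom : Set ℝ}
    (hdc : dom.OrdConnected) (hγ : ∀ s ∈ dom, ContinuousAt γ s) {O : Set X} (hO : IsOpen O) {t s₁ : ℝ}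
    (ht : t ∈ dom) (hs₁ : s₁ ∈ dom) (hts₁ : t ≤ s₁) (hγt : γ t ∈ O) (hγs₁ : γ s₁ ∉ O) :
    ∃ T ∈ dom, t < T ∧ T ≤ s₁ ∧ (∀ s ∈ Ico t T, γ s ∈ O) ∧ γ T ∉ O ∧ γ T ∈ closure O := by
  set A : Set ℝ := {s | t ≤ s ∧ s ≤ s₁ ∧ γ s ∉ O} with hA
  have hAne : A.Nonempty := ⟨s₁, hts₁, le_rfl, hγs₁⟩
  have hAbdd : BddBelow A := ⟨t, fun s hs ↦ hs.1⟩
  set T := sInf A with hT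
  have htT : t ≤ T := le_csInf hAne fun s hs ↦ hs.1
  have hTs₁ : T ≤ s₁ := csInf_le hAbdd ⟨hts₁, le_rfl, hγs₁⟩
  have hTdom : T ∈ dom := hdc.out ht hs₁ ⟨htT, hTs₁⟩
  -- below `T` the curve is inside `O`
  have hin : ∀ s ∈ Ico t T, γ s ∈ O := by
    intro s hs
    by_contra hnot
    have hsA : s ∈ A := ⟨hs.1, (hs.2.le.trans hTs₁), hnot⟩
    exact absurd (csInf_le hAbdd hsA) (not_le.2 hs.2)
  -- `γ T ∉ O`: otherwise a neighbourhood of `T` is `A`-free and `T < inf A`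
  have hout : γ T ∉ O := by
    intro hTO
    have hnhds : ∀ᶠ s in 𝓝 T, γ s ∈ O := (hγ T hTdom).preimage_mem_nhds (hO.mem_nhds hTO)
    obtain ⟨ε, hε, hball⟩ := Metric.eventually_nhds_iff.1 hnhds
    -- every element of `A` is `≥ T + ε / 2`-ish: elements below `T` do not exist, elements near `T` are in `O`
    have hlb : ∀ s ∈ A, T + ε / 2 ≤ s := by
      intro s hs
      by_contra hlt
      push Not at hlt
      have hTs : T ≤ s := csInf_le hAbdd hs
      have hdist : dist s T < ε := by
        rw [Real.dist_eq, abs_of_nonneg (by linarith)]; linarith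
      exact hs.2.2 (hball hdist)
    have := le_csInf hAne hlb
    linarith
  have htT' : t < T := lt_of_le_of_ne htT fun h ↦ hout (h ▸ hγt)
  -- `γ T` is a limit of points of `O`
  have hcl : γ T ∈ closure O := by
    have hcont : ContinuousWithinAt γ (Ico t T) T := (hγ T hTdom).continuousWithinAt
    have hTcl : T ∈ closure (Ico t T) := by
      rw [closure_Ico htT'.ne]; exact right_mem_Icc.2 htT
    have hmap : MapsTo γ (Ico t T) O := fun s hs ↦ hin s hs
    exact hcont.mem_closure hTcl hmap
  exact ⟨T, hTdom, htT', hTs₁, hin, hout, hcl⟩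

/-- **Registered form** (`stub_valRiemannImmersionChart`, explicit binders) of `val_riemann_immersionChart`: the
curvature of `g` on pushed-forward vectors, paired with `g`, is the curvature of `Ψ^* g` paired with `Ψ^* g`.
[cite: ONeillSemiRiemannian1983, Ch. 3, Prop. 3.59] -/
theorem stub_valRiemannImmersionChart :
    ∀ (𝓢 : Spacetime.{0} 4) (U : TopologicalSpace.Opens E4) (Ψ : U → 𝓢.carrier) (hΨ : ContMDiff 𝓘(ℝ, E4) (𝓡 4) (∞ + 1) Ψ) (hΨ' : ∀ u, Function.Injective (mfderiv 𝓘(ℝ, E4) (𝓡 4) Ψ u)) (hdim : Module.finrank ℝ E4 = Module.finrank ℝ (EuclideanSpace ℝ (Fin 4))), ∀ [𝓢.metric.HasLeviCivita] [(ImmersionChart.metric 𝓢.metric.toPseudoRiemannianMetric hΨ hΨ' hdim).HasLeviCivita] (u : U) (a b c d : E4), 𝓢.metric.val (Ψ u) (𝓢.metric.toPseudoRiemannianMetric.riemann (Ψ u) (mfderiv 𝓘(ℝ, E4) (𝓡 4) Ψ u a) (mfderiv 𝓘(ℝ, E4) (𝓡 4) Ψ u b) (mfderiv 𝓘(ℝ,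 E4) (𝓡 4) Ψ u c)) (mfderiv 𝓘(ℝ, E4) (𝓡 4) Ψ u d) = (ImmersionChart.metric 𝓢.metric.toPseudoRiemannianMetric hΨ hΨ' hdim).val u ((ImmersionChart.metric 𝓢.metric.toPseudoRiemannianMetric hΨ hΨ' hdim).riemann u a b c) d :=
  fun 𝓢 U Ψ hΨ hΨ' hdim _ _ u a b c d ↦ val_riemann_immersionChart 𝓢 U Ψ hΨ hΨ' hdim u a b c d

end Summit.FinalStateConjecture.FinalStateConjecture.Theorems.PhotonSphereChannels.TameCensorshipUnwind

end
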